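/-
Copyright (c) 2026 the pub-hodgecm-mathlib formalisation cell (harness21).  Prover seat hodgecm-mathlib-F0P3a-p01 (g34), req620 Track A «(D-RAM) FOUR-FRAME» squad, unit U2H:
the (ρ2b′-X) child (U2H ED. 15 :418) — the FLIP-UNIT TOKEN `hFN` of the bottom census socket (C⁗) v2 (payer LH4-p14 (g4) «hFN DOWN», `SOCKET-hOC.v2` 220f9860), TYPE-FREE.
2026-09-04.
-/
import Summits.HodgeConjecture.HodgeConjecture.Theorems.F0P3cDyRamTokenSignUnr      -- ★ p857454 `exists_antifixed_sq_eq_toPlace_cmQuadraticGenerator`, `exists_toPlace_eq_of_fixed`; brings ★ `hilbertSymbol_eq_one_iff_exists_norm_toPlace`, ★ bilinearity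
import Literature.NumberTheory.LocalFields.QuadraticDatumNormsOfDoublyFixedUnits     -- ★ p857325 `WildQuadraticDatum.exists_mul_map_eq_mul_map_of_theta_fixed` (ρ-averaging under the Θ unit-norm dichotomy)
import HarnessLib

/-!
# Crux `H413`, line LH4 «(D-RAM) FOUR-FRAME» road — unit U2H, (ρ2b′-X): THE FLIP-UNIT TOKEN `hFN` IS TYPE-FREE — every doubly fixed unit of the eigen-field is a `Θ`-norm

Cell `hodgecm-mathlib` (D-0151), FLOOR 0, crux item H413 = `stmt-HodgeConjecture-24833`, route of record `HCCMUnconditional`; squad F0∕P3c∕LH4; registered stub served: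
`F0P3cDyRamFourFrameU2H.stub_U2H_fixedPointCensus_typeTwo_unit0` ((ρ2b′-X), U2H ED. 15 :418) through the payer's (C)-chain v3 (★ OfOrgansV3 ∘ CensusOfFrameV3 ∘
CensusOfLineModelsV3 ∘ …Fin ∘ ★ p857871 ∘ ★ p857872), whose one open socket is (C⁗) v2 `SOCKET-hOC.v2.LH4p14g4.txt` (220f9860): the ORDER-COUNT census AND the conjunct
`hFN : ∀ f₀, ρ f₀ = f₀ → Θ f₀ = f₀ → |f₀| = 1 → ∃ z, z * Θ z = f₀` (payer LH4-p14 (g4) 2026-09-04T06:16Z «hFN DOWN»: proved by the bottom census prover, per descent type —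
U ★ `exists_mul_map_eq_of_finite_residueField`, RamK ★ `exists_mul_map_eq_of_fixed_fixed_of_thirdField`, RamM OPEN).  THIS FILE DISCHARGES `hFN` AT EVERY TYPE AT ONCE, from the
letters (C⁗) v2 already carries plus the `Θ` unit-norm dichotomy token of ★ p857325 (RamK∕RamM: ★ `exists_unit_norm_dichotomy_of_isRamifiedQuadraticDatum` on `hDΘ`; U: `c₀ := 1`,
`Or.inl` of ★ `exists_mul_map_eq_of_finite_residueField`).  THEOREMS ONLY (no `def`, no instance, no notation, no `sorry`); lane `--supports stmt-HodgeConjecture-24833 --as helper`.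

THE ARGUMENT (no class field theory, no norm-group comparison).  `M ⊇ jE(L_w)`, `ρ = Gal(M∕L_w)`, `Θ` a commuting involution with `Θ ∘ jE = jE ∘ σ_w`; a doubly fixed unit is
`f₀ = jE(ι_w b)` with `b ∈ L⁺_vˣ` (★ `exists_toPlace_eq_of_fixed`).  Let `θ` = `cmQuadraticGenerator L` (`L_w = L⁺_v(√θ)`, ★ `exists_antifixed_sq_eq_toPlace_cmQuadraticGenerator`:
`ω² = ι_w θ`, `σ_w ω = −ω`) and let `ξ ∈ Mˣ` be ANTI-fixed by both `ρ` and `Θ` (built here from `lam`: one of `(lam − Θlam) − ρ(lam − Θlam)`, `jE ω·((lam + Θlam) − ρ(lam + Θlam))`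
is non-zero since `ρ lam ≠ lam`), so `ξ² = jE(ι_w c)` with `c ∈ L⁺_vˣ`.  Three cases on the local Hilbert symbols over `L⁺_v`:
* `(b, θ)_v = 1`: `ι_w b = σ_w e · e` (★ `hilbertSymbol_eq_one_iff_exists_norm_toPlace`) and `z := jE e` has `z·Θz = f₀`;
* `(b, c)_v = 1`: `b = p² − c q²`, and `z := jE(ι_w p) + jE(ι_w q)·ξ` has `Θz = jE(ι_w p) − jE(ι_w q)·ξ`, `z·Θz = f₀`;
* `(b, θ)_v = (b, c)_v = −1`: `(b, θc)_v = 1` (★ bilinearity `hilbertSymbol_adicCompletion_mul_right`), `b = p² − θc q²`, and `g := jE(ι_w p) + jE(ι_w q)·(jE ω·ξ)` is a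
  `Θ`-FIXED UNIT with `g·ρg = f₀`; by `ρ`-AVERAGING under the dichotomy (★ `exists_mul_map_eq_mul_map_of_theta_fixed`) `g·ρg` is a `Θ`-norm.
(R-26) inhabitants: every letter is a (C⁗) v2 letter (`hρρ hvρ hjfix hΘj hΘρ`, `Θ lam * lam = 1`; `ρ lam ≠ lam` from the rootless characteristic polynomial) or the ★ dichotomy
token; instance ℚ₂(ζ₈) ⊃ ℚ₂(i) (REF5 R5-201: `N(U_E)·N(U_{K♮})` etc. — not needed here).
HONEST LABEL.  Count-neutral helper; pays the `hFN` conjunct of an OPEN socket, closes nothing by itself; (ρ2b′-X) stays an OPEN prover target; `HC_CM` is proved only modulo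
the 7 printed citations (2 remaining named inputs: hLiu418 = `stmt-HodgeConjecture-24832`, h413 = `stmt-HodgeConjecture-24833`) until rung 0 closes.

## References
* [Serre1979] J.-P. Serre, *Local Fields*, GTM 67 (1979), Ch. V §3 Cor. 3 p. 86; Ch. XIV §3.
* [Omeara1963] O. T. O'Meara, *Introduction to Quadratic Forms* (1963), §63B (63:10, 63:13a).
* [Rogawski1990] J. D. Rogawski, *Automorphic Representations of Unitary Groups in Three Variables*, Ann. of Math. Stud. 123 (1990), §4.9 p. 55.
-/

set_option autoImplicit false

noncomputable section

open NumberField IsDedekindDomain WithZero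
open Literature.NumberTheory.Automorphic Literature.NumberTheory.Automorphic.UnitaryGroup
open Literature.NumberTheory.QuadraticForms Literature.NumberTheory.Rogawski1990
open Literature.NumberTheory.LocalFields.WildQuadraticDatum
open scoped Valued

namespace Summit.HodgeConjecture.HodgeConjecture.Cruxes.H413.F0P3cDyRamFlipUnitToken

/-! ## §1 Algebra: a binary norm form representing `b` -/

section Algebra

variable {F M : Type} [Field F] [Field M]

/-- From `b·x² + c·y² = 1` with `x ≠ 0`: `b = (x⁻¹)² − c·(y∕x)²`. [cite: Omeara1963, §63B (63:10)] -/
theorem eq_sq_sub_mul_sq_of_eq_one {b c x y : F} (hx : x ≠ 0) (h : b * x ^ 2 + c * y ^ 2 = 1) :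
    b = x⁻¹ ^ 2 - c * (y / x) ^ 2 := by
  field_simp
  linear_combination h

/-- In `M`: `(P + Q·ξ)·(P − Q·ξ) = P² − ξ²·Q²`. [folklore] -/
theorem add_mul_mul_sub_mul (P Q ξ : M) : (P + Q * ξ) * (P - Q * ξ) = P ^ 2 - ξ ^ 2 * Q ^ 2 := by ring

end Algebra

/-! ## §2 The token -/

section CM

variable (L : Type) [Field L] [NumberField L] [IsCMField L] {v : HeightOneSpectrum (𝓞 ↥(maximalRealSubfield L))}
  (w : PlacesOver L v) (hw : IsCMField.complexConj L • w.1 = w.1)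

include hw in
/-- **THE FLIP-UNIT TOKEN `hFN`, TYPE-FREE.**  `M ⊇ jE(L_w)` a valued field with commuting ring endomorphisms `ρ` (involution, isometric, fixed points `= jE(L_w)`) and `Θ`
(`Θ ∘ jE = jE ∘ σ_w`), an element `lam` with `Θ lam · lam = 1` and `ρ lam ≠ lam`, and the `Θ` unit-norm dichotomy (`Θ`-fixed units `⊆ N ∪ c₀⁻¹N`): then EVERY unit `f₀` fixed by `ρ`
and `Θ` is a norm `z·Θz`.  (Three Hilbert-symbol cases over `L⁺_v`, see the module docstring.) [cite: Serre1979, Ch. V §3 Cor. 3 p. 86] [cite: Omeara1963, §63B (63:10, 63:13a)] -/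
theorem exists_mul_theta_eq_of_fixed_fixed {M : Type} [Field M] [Valued M ℤᵐ⁰] (jE : w.1.adicCompletion L →+* M) (ρ Θ : M →+* M)
    (hρρ : ∀ z, ρ (ρ z) = z) (hvρ : ∀ z, Valued.v (ρ z) = Valued.v z) (hjfix : ∀ z : M, ρ z = z ↔ ∃ a, jE a = z)
    (hΘj : ∀ a, Θ (jE a) = jE (galAdicCompletionMap (L := L) (IsCMField.complexConj L) hw a)) (hΘρ : ∀ z, Θ (ρ z) = ρ (Θ z))
    {lam : M} (hΘlam : Θ lam * lam = 1) (hρlam : ρ lam ≠ lam)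
    {c₀ : M} (hΘc₀ : Θ c₀ = c₀) (hc₀ : Valued.v c₀ = 1)
    (hdich : ∀ u : M, Θ u = u → Valued.v u = 1 → (∃ z : M, z * Θ z = u) ∨ ∃ z : M, z * Θ z = c₀ * u)
    {f₀ : M} (hρf : ρ f₀ = f₀) (hΘf : Θ f₀ = f₀) (hf : Valued.v f₀ = 1) : ∃ z : M, z * Θ z = f₀ := by
  classical
  set σ := galAdicCompletionMap (L := L) (IsCMField.complexConj L) hw with hσdef
  haveI : CharZero (w.1.adicCompletion L) := charZero_of_injective_algebraMap (algebraMap L (w.1.adicCompletion L)).injective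
  have hjinj : Function.Injective jE := jE.injective
  have h2M : (2 : M) ≠ 0 := by rw [← map_ofNat jE 2]; exact (map_ne_zero_iff jE hjinj).2 two_ne_zero
  -- the embedding `ι = jE ∘ ι_w` of `L⁺_v` and its fixedness
  have hσι : ∀ p : v.adicCompletion ↥(maximalRealSubfield L), σ (toPlace v w p) = toPlace v w p := fun p =>
    galAdicCompletionMap_toPlace (IsCMField.complexConj L) w w hw p
  have hΘι : ∀ p : v.adicCompletion ↥(maximalRealSubfield L), Θ (jE (toPlace v w p)) = jE (toPlace v w p) := fun p => by
    rw [hΘj, hσι]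
  have hρι : ∀ a : w.1.adicCompletion L, ρ (jE a) = jE a := fun a => (hjfix (jE a)).2 ⟨a, rfl⟩
  -- descent of doubly fixed elements to `L⁺_v`
  have hdesc : ∀ z : M, ρ z = z → Θ z = z → ∃ p : v.adicCompletion ↥(maximalRealSubfield L), jE (toPlace v w p) = z := by
    intro z hρz hΘz
    obtain ⟨a, rfl⟩ := (hjfix z).1 hρz
    have hσa : σ a = a := hjinj (by rw [← hΘj]; exact hΘz)
    obtain ⟨p, hp⟩ := F0P3cDyRamTokenSignUnr.exists_toPlace_eq_of_fixed L w hw a hσa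
    exact ⟨p, by rw [hp]⟩
  obtain ⟨b, hb⟩ := hdesc f₀ hρf hΘf
  have hf0 : f₀ ≠ 0 := fun h0 => by rw [h0, map_zero] at hf; exact zero_ne_one hf
  have hb0 : b ≠ 0 := fun h0 => hf0 (by rw [← hb, h0, map_zero, map_zero])
  -- `√θ ∈ L_w`
  obtain ⟨ω, hω0, hσω, hωsq⟩ := F0P3cDyRamTokenSignUnr.exists_antifixed_sq_eq_toPlace_cmQuadraticGenerator L w hw
  set θv : v.adicCompletion ↥(maximalRealSubfield L) :=
    algebraMap ↥(maximalRealSubfield L) (v.adicCompletion ↥(maximalRealSubfield L)) ((cmQuadraticGenerator L : 𝓞 ↥(maximalRealSubfield L)) : ↥(maximalRealSubfield L)) with hθv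
  have hθ0 : θv ≠ 0 := by
    intro h0
    rw [h0, map_zero] at hωsq
    exact hω0 (pow_eq_zero_iff (n := 2) (by norm_num) |>.1 hωsq)
  have hΘω : Θ (jE ω) = -jE ω := by rw [hΘj, hσω, map_neg]
  have hρω : ρ (jE ω) = jE ω := hρι ω
  -- an element `ξ ≠ 0` anti-fixed by `ρ` and by `Θ`
  have hlam0 : lam ≠ 0 := fun h0 => by rw [h0, mul_zero] at hΘlam; exact zero_ne_one hΘlam
  have hΘl : Θ lam = lam⁻¹ := eq_inv_of_mul_eq_one_left hΘlam
  have hΘΘl : Θ (Θ lam) = lam := by rw [hΘl, map_inv₀, hΘl, inv_inv]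
  have hΘρl : Θ (ρ lam) = ρ (Θ lam) := hΘρ lam
  have hΘρΘl : Θ (ρ (Θ lam)) = ρ lam := by rw [hΘρ, hΘΘl]
  obtain ⟨ξ, hξ0, hρξ, hΘξ⟩ : ∃ ξ : M, ξ ≠ 0 ∧ ρ ξ = -ξ ∧ Θ ξ = -ξ := by
    by_cases h2 : (lam - Θ lam) - ρ (lam - Θ lam) = 0
    · refine ⟨jE ω * ((lam + Θ lam) - ρ (lam + Θ lam)), mul_ne_zero ((map_ne_zero_iff jE hjinj).2 hω0) ?_, ?_, ?_⟩
      · intro h1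
        apply hρlam
        have e1 : ρ (lam + Θ lam) = lam + Θ lam := by linear_combination -h1
        have e2 : ρ (lam - Θ lam) = lam - Θ lam := by linear_combination -h2
        have e3 : ρ (2 * lam) = 2 * lam := by
          rw [show 2 * lam = (lam + Θ lam) + (lam - Θ lam) by ring, map_add, e1, e2]
        rw [map_mul, map_ofNat] at e3
        exact mul_left_cancel₀ h2M e3
      · simp only [map_mul, map_sub, map_add, hρω, hρρ]
        ring
      · simp only [map_mul, map_sub, map_add, hΘω, hΘΘl, hΘρl, hΘρΘl]
        ring
    · refine ⟨(lam - Θ lam) - ρ (lam - Θ lam), h2, ?_, ?_⟩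
      · simp only [map_sub, hρρ]
        ring
      · simp only [map_sub, hΘΘl, hΘρl, hΘρΘl]
        ring
  -- `ξ² = jE (ι_w c)`
  have hρξ2 : ρ (ξ ^ 2) = ξ ^ 2 := by rw [map_pow, hρξ, neg_sq]
  have hΘξ2 : Θ (ξ ^ 2) = ξ ^ 2 := by rw [map_pow, hΘξ, neg_sq]
  obtain ⟨c, hc⟩ := hdesc (ξ ^ 2) hρξ2 hΘξ2
  have hc0 : c ≠ 0 := fun h0 => by
    rw [h0, map_zero, map_zero] at hc
    exact pow_ne_zero 2 hξ0 hc.symm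
  -- the three Hilbert-symbol cases over `L⁺_v`
  by_cases hbθ : hilbertSymbol (v.adicCompletion ↥(maximalRealSubfield L)) b θv = 1
  · -- (i) `b` is a norm from `L_w`
    obtain ⟨e, he⟩ := (hilbertSymbol_eq_one_iff_exists_norm_toPlace L v w hw hb0).1 hbθ
    refine ⟨jE e, ?_⟩
    rw [hΘj, ← map_mul, mul_comm, he, hb]
  by_cases hbc : hilbertSymbol (v.adicCompletion ↥(maximalRealSubfield L)) b c = 1
  · -- (ii) `b = p² − c q²`, a norm of `p + q ξ`
    obtain ⟨x, y, hxy⟩ := (hilbertSymbol_eq_one_iff b c).1 hbc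
    have hx : x ≠ 0 := by
      intro hx0
      rw [hx0] at hxy
      have hcy : c * y ^ 2 = 1 := by linear_combination hxy
      -- then `(ξ · ι y)² = 1`, so `ξ · ι y = ±1` is `ρ`-fixed: contradiction with `ρ ξ = −ξ`
      have hsq : (ξ * jE (toPlace v w y)) ^ 2 = 1 := by
        rw [mul_pow, ← hc, ← map_pow, ← map_pow, ← map_mul, ← map_mul, hcy, map_one, map_one]
      have hρP : ρ (ξ * jE (toPlace v w y)) = -(ξ * jE (toPlace v w y)) := by rw [map_mul, hρξ, hρι]; ring
      rw [sq] at hsq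
      rcases mul_self_eq_one_iff.1 hsq with h1 | h1
      · rw [h1, map_one] at hρP; exact h2M (by linear_combination hρP)
      · rw [h1, map_neg, map_one] at hρP; exact h2M (by linear_combination -hρP)
    have hbpq := eq_sq_sub_mul_sq_of_eq_one hx hxy
    refine ⟨jE (toPlace v w x⁻¹) + jE (toPlace v w (y / x)) * ξ, ?_⟩
    have hΘz : Θ (jE (toPlace v w x⁻¹) + jE (toPlace v w (y / x)) * ξ) = jE (toPlace v w x⁻¹) - jE (toPlace v w (y / x)) * ξ := by
      rw [map_add, map_mul, hΘι, hΘι, hΘξ]; ring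
    rw [hΘz, add_mul_mul_sub_mul, ← hc, ← hb, hbpq]
    simp only [map_sub, map_mul, map_pow]
  · -- (iii) `(b, θc) = 1`: `b = g·ρg` for a `Θ`-fixed unit `g`, then `ρ`-averaging
    have hbθ' := (hilbertSymbol_ne_one_iff _ _).1 hbθ
    have hbc' := (hilbertSymbol_ne_one_iff _ _).1 hbc
    have hbθc : hilbertSymbol (v.adicCompletion ↥(maximalRealSubfield L)) b (θv * c) = 1 := by
      rw [hilbertSymbol_adicCompletion_mul_right ↥(maximalRealSubfield L) v hθ0 hc0 hb0, hbθ', hbc']; norm_num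
    obtain ⟨x, y, hxy⟩ := (hilbertSymbol_eq_one_iff b (θv * c)).1 hbθc
    have hx : x ≠ 0 := by
      intro hx0
      rw [hx0] at hxy
      have hcy : θv * c * y ^ 2 = 1 := by linear_combination hxy
      have hsq : (jE ω * ξ * jE (toPlace v w y)) ^ 2 = 1 := by
        rw [mul_pow, mul_pow, ← map_pow, hωsq, ← hc, ← map_pow, ← map_pow, ← map_mul, ← map_mul, ← map_mul, ← map_mul, hcy, map_one, map_one]
      have hρP : ρ (jE ω * ξ * jE (toPlace v w y)) = -(jE ω * ξ * jE (toPlace v w y)) := by rw [map_mul, map_mul, hρω, hρξ, hρι]; ring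
      rw [sq] at hsq
      rcases mul_self_eq_one_iff.1 hsq with h1 | h1
      · rw [h1, map_one] at hρP; exact h2M (by linear_combination hρP)
      · rw [h1, map_neg, map_one] at hρP; exact h2M (by linear_combination -hρP)
    have hbpq := eq_sq_sub_mul_sq_of_eq_one hx hxy
    set g : M := jE (toPlace v w x⁻¹) + jE (toPlace v w (y / x)) * (jE ω * ξ) with hg
    have hΘg : Θ g = g := by
      rw [hg, map_add, map_mul, map_mul, hΘι, hΘι, hΘω, hΘξ, neg_mul_neg]
    have hρg : ρ g = jE (toPlace v w x⁻¹) - jE (toPlace v w (y / x)) * (jE ω * ξ) := by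
      rw [hg, map_add, map_mul, map_mul, hρι, hρι, hρω, hρξ]; ring
    have hgρg : g * ρ g = f₀ := by
      rw [hρg, hg, add_mul_mul_sub_mul, mul_pow, ← map_pow jE ω, hωsq, ← hc, ← hb, hbpq]
      simp only [map_sub, map_mul, map_pow]
    have hvg : Valued.v g = 1 := by
      have h1 : Valued.v (g * ρ g) = 1 := by rw [hgρg, hf]
      rw [Valuation.map_mul, hvρ] at h1
      exact v_eq_one_of_v_mul_map_eq_one (σ := ρ) hvρ (by rw [Valuation.map_mul, hvρ]; exact h1)
    obtain ⟨z, hz⟩ := exists_mul_map_eq_mul_map_of_theta_fixed hρρ hvρ hΘρ hΘc₀ hc₀ hdich hΘg hvg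
    exact ⟨z, by rw [hz, hgρg]⟩

include hw in
/-- **The same in the letters of the bottom census socket (C⁗) v2** (`SOCKET-hOC.v2.LH4p14g4.txt` 220f9860): `ρ lam ≠ lam` is read off the line-model letters
`lam² = jE t·lam − jE D` and the ROOTLESS characteristic polynomial `∀ x, x² − t x + D ≠ 0`; the remaining input is the `Θ` unit-norm dichotomy token `(c₀, hdich)`
(RamK∕RamM: ★ `exists_unit_norm_dichotomy_of_isRamifiedQuadraticDatum`; U: `c₀ := 1`).  Output = the `hFN` conjunct of (C⁗) v2 verbatim (at `jE := toPlace w.1 w₁`,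
`ρ := galAdicCompletionMap c₁ hw₁`). [cite: Serre1979, Ch. V §3 Cor. 3 p. 86] [cite: Omeara1963, §63B (63:13a)] -/
theorem hFN_of_dichotomy {M : Type} [Field M] [Valued M ℤᵐ⁰] (jE : w.1.adicCompletion L →+* M) (ρ Θ : M →+* M)
    (hρρ : ∀ z, ρ (ρ z) = z) (hvρ : ∀ z, Valued.v (ρ z) = Valued.v z) (hjfix : ∀ z : M, ρ z = z ↔ ∃ a, jE a = z)
    (hΘj : ∀ a, Θ (jE a) = jE (galAdicCompletionMap (L := L) (IsCMField.complexConj L) hw a)) (hΘρ : ∀ z, Θ (ρ z) = ρ (Θ z))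
    {t D : w.1.adicCompletion L} (hirr : ∀ x : w.1.adicCompletion L, x * x - t * x + D ≠ 0)
    {lam : M} (hlam : lam * lam = jE t * lam - jE D) (hΘlam : Θ lam * lam = 1)
    {c₀ : M} (hΘc₀ : Θ c₀ = c₀) (hc₀ : Valued.v c₀ = 1)
    (hdich : ∀ u : M, Θ u = u → Valued.v u = 1 → (∃ z : M, z * Θ z = u) ∨ ∃ z : M, z * Θ z = c₀ * u) :
    ∀ f₀ : M, ρ f₀ = f₀ → Θ f₀ = f₀ → Valued.v f₀ = 1 → ∃ z : M, z * Θ z = f₀ := by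
  have hρlam : ρ lam ≠ lam := by
    intro h
    obtain ⟨a, ha⟩ := (hjfix lam).1 h
    apply hirr a
    apply jE.injective
    rw [map_zero, map_add, map_sub, map_mul, map_mul, ha]
    linear_combination hlam
  intro f₀ hρf hΘf hf
  exact exists_mul_theta_eq_of_fixed_fixed L w hw jE ρ Θ hρρ hvρ hjfix hΘj hΘρ hΘlam hρlam hΘc₀ hc₀ hdich hρf hΘf hf

end CM

end Summit.HodgeConjecture.HodgeConjecture.Cruxes.H413.F0P3cDyRamFlipUnitToken

end
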